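import Mathlib
import Summits.ValiantsHypothesis.ValiantsHypothesis.Theorems.DivisionGapPerMultiplesHardStubFaceDescent
import Summits.ValiantsHypothesis.ValiantsHypothesis.Theorems.DivisionGapPerMultiplesHardStubAlignedRigidity
import Literature.Computability.AlgebraicComplexity.ArithCircuitProofs

/-!
# `DivisionGap.PerMultiplesHard` (stmt-ValiantsHypothesis-5068), line `uncharged-face-walk`:
slicing one LEVEL out of a typed factor is free (stub `stub_levelSlice`)

Let `c ∈ ℝ≥0[x_ij]` (`m × m` variables) be *typed*: every exponent of `c` has row margins `ρ`
and column margins `γ`.  An exponent is *pure* if it is supported inside the graph `{(σ j, j)}`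
of a permutation `σ`.  Fix a level `v` and let `k := #{i | ρ i = v}`.  If `c` has a pure
exponent, then

* `#{i | ρ i = v} = #{j | γ j = v}`;
* there is `c'` on the same board with `L⁺(c') ≤ L⁺(c)` all of whose exponents have row margins
  `v · 𝟙{ρ i = v}` and column margins `v · 𝟙{γ j = v}`, and which contains the level slice
  `A|_{ρ = v} := A.filter (ρ ·.1 = v)` of EVERY pure exponent `A` of `c`.

Proof.
1. (`typed_of_served`) a pure exponent inside `σ` has in column `j` the single cell `(σ j, j)`
   carrying the whole row margin, so `ρ (σ j) = γ j` for all `j`, and `j ↦ σ j` is a bijection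
   from `{γ = v}` onto `{ρ = v}`.
2. `c' := top_W (prj c)` with the *level projection* `prj x_e := x_e` if `ρ e.1 = v`,
   `prj x_e := 1` otherwise, and the column weight `W e := 𝟙{γ e.2 = v}`.  Projections are free
   (`IsProjection.complexity_le_holds`) and top components are free over `ℝ≥0`
   (`complexity_topComponent_le`).
3. `prj (a · x^A) = a · x^{A|_{ρ = v}}` (`FaceDescent.aeval_proj_monomial`), so over `ℝ≥0` the
   exponents of `prj c` are exactly the slices `A|_{ρ = v}`, `A ∈ supp c` (no cancellation).
   A slice has row sums `v · 𝟙{ρ = v}`, total mass `v · k`, column sums `≤ γ j`, hence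
   `W`-weight `≤ v · k`; the slice of a PURE exponent inside `σ` has all its mass in the columns
   `σ⁻¹ {ρ = v} = {γ = v}`, so its `W`-weight is exactly `v · k`, which is therefore the top
   `W`-weight of `prj c`: the pure slices survive in `c'`.  Conversely an exponent of `c'` has
   `W`-weight `v · k` = its mass, so its columns off `{γ = v}` are empty and its `k` columns in
   `{γ = v}` carry `≤ v` each with total `v · k`, hence exactly `v` each.

Log (stub-worker): written on the `FaceDescent` / `TopComponentFree` / `AlignedRigidity` API;
the generic projection-support lemma is re-proved here for the level predicate (the `HostDescent`
module keyed on a finset `G` was not yet built on the farm). [folklore]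
-/

noncomputable section

open MvPolynomial Literature.Computability.AlgebraicComplexity
open scoped NNReal BigOperators
open Summit.ValiantsHypothesis.ValiantsHypothesis.Theorems.ZeroOneTransfer.Negative

namespace Summit.ValiantsHypothesis.ValiantsHypothesis.Theorems.DivisionGap.PerMultiplesHard.LevelSlice

variable {m : ℕ}

/-! ### The level projection `x_e ↦ x_e` (`ρ e.1 = v`), `x_e ↦ 1` (otherwise) -/

/-- The level projection maps `a · x^A` to `a · x^{A|_{ρ = v}}`. [folklore] -/
theorem aeval_prj_monomial (ρ : Fin m → ℕ) (v : ℕ) (A : (Fin m × Fin m) →₀ ℕ) (a : ℝ≥0) :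
    aeval (fun e : Fin m × Fin m =>
        if ρ e.1 = v then (X e : MvPolynomial (Fin m × Fin m) ℝ≥0) else 1) (monomial A a) =
      monomial (A.filter (fun e => ρ e.1 = v)) a := by
  have hG : ∀ e : Fin m × Fin m, e ∈ Finset.univ.filter (fun e : Fin m × Fin m => ρ e.1 = v) ↔
      ρ e.1 = v := fun e => by simp
  have hfun : (fun e : Fin m × Fin m =>
        if ρ e.1 = v then (X e : MvPolynomial (Fin m × Fin m) ℝ≥0) else 1) =
      fun e => if e ∈ Finset.univ.filter (fun e : Fin m × Fin m => ρ e.1 = v) then X e else 1 :=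
    funext fun e => if_congr (hG e).symm rfl rfl
  rw [hfun]
  refine FaceDescent.aeval_proj_monomial _ (d' := A.filter (fun e => ρ e.1 = v))
    (fun e he => ?_) (fun e he => ?_) a
  · rw [Finsupp.support_filter] at he
    exact (hG e).2 (Finset.mem_filter.1 he).2
  · exact (Finsupp.filter_apply_pos (fun e => ρ e.1 = v) A ((hG e).1 he)).symm

/-- The level projection of `p`, monomial by monomial. [folklore] -/
theorem aeval_prj_eq_sum (ρ : Fin m → ℕ) (v : ℕ) (p : MvPolynomial (Fin m × Fin m) ℝ≥0) :
    aeval (fun e : Fin m × Fin m =>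
        if ρ e.1 = v then (X e : MvPolynomial (Fin m × Fin m) ℝ≥0) else 1) p =
      ∑ A ∈ p.support, monomial (A.filter (fun e => ρ e.1 = v)) (coeff A p) := by
  conv_lhs => rw [p.as_sum]
  rw [map_sum]
  exact Finset.sum_congr rfl fun A _ => aeval_prj_monomial ρ v A _

-- adapted from `HostDescent.mem_support_aeval_proj_iff` (finset-keyed; module not yet built)
/-- Over `ℝ≥0` there is no cancellation: `x^d` occurs in the level projection of `p` iff `d` is
the level slice `A|_{ρ = v}` of some exponent `A` of `p`. [folklore] -/
theorem mem_support_aeval_prj_iff (ρ : Fin m → ℕ) (v : ℕ) (p : MvPolynomial (Fin m × Fin m) ℝ≥0)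
    (d : (Fin m × Fin m) →₀ ℕ) :
    d ∈ (aeval (fun e : Fin m × Fin m =>
        if ρ e.1 = v then (X e : MvPolynomial (Fin m × Fin m) ℝ≥0) else 1) p).support ↔
      ∃ A ∈ p.support, A.filter (fun e => ρ e.1 = v) = d := by
  classical
  rw [mem_support_iff, aeval_prj_eq_sum, coeff_sum, Ne, Finset.sum_eq_zero_iff]
  push Not
  refine exists_congr fun A => and_congr_right fun hA => ?_
  rw [coeff_monomial]
  constructor
  · intro h
    by_contra hne
    exact h (if_neg hne)
  · intro h
    rw [if_pos h]
    exact mem_support_iff.1 hA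

/-! ### Margins and weight of a level slice -/

/-- Row sums of the level slice of an exponent with row margins `ρ`: `v` on the rows of level
`v`, `0` elsewhere. [folklore] -/
theorem rowSum_slice (ρ : Fin m → ℕ) (v : ℕ) {A : (Fin m × Fin m) →₀ ℕ}
    (hr : ∀ i, ∑ j, A (i, j) = ρ i) (i : Fin m) :
    ∑ j, (A.filter (fun e => ρ e.1 = v)) (i, j) = if ρ i = v then v else 0 := by
  by_cases hi : ρ i = v
  · rw [if_pos hi]
    calc ∑ j, (A.filter (fun e => ρ e.1 = v)) (i, j) = ∑ j, A (i, j) :=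
          Finset.sum_congr rfl fun j _ => Finsupp.filter_apply_pos (fun e => ρ e.1 = v) A hi
      _ = v := (hr i).trans hi
  · rw [if_neg hi]
    exact Finset.sum_eq_zero fun j _ => Finsupp.filter_apply_neg (fun e => ρ e.1 = v) A hi

/-- Column sums only drop under slicing. [folklore] -/
theorem colSum_slice_le (ρ : Fin m → ℕ) (v : ℕ) (A : (Fin m × Fin m) →₀ ℕ) (j : Fin m) :
    ∑ i, (A.filter (fun e => ρ e.1 = v)) (i, j) ≤ ∑ i, A (i, j) :=
  Finset.sum_le_sum fun i _ => by
    rw [Finsupp.filter_apply]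
    split_ifs
    · exact le_rfl
    · exact Nat.zero_le _

/-- An exponent with row sums `v · 𝟙{ρ = v}` has total mass `v · #{ρ = v}`. [folklore] -/
theorem sum_colSum_eq (ρ : Fin m → ℕ) (v : ℕ) {M : (Fin m × Fin m) →₀ ℕ}
    (hr : ∀ i, ∑ j, M (i, j) = if ρ i = v then v else 0) :
    ∑ j, ∑ i, M (i, j) = v * (Finset.univ.filter fun i => ρ i = v).card := by
  rw [Finset.sum_comm]
  simp_rw [hr]
  rw [← Finset.sum_filter, Finset.sum_const, smul_eq_mul, mul_comm]

/-- The weight of an exponent for the indicator `W` of the columns of level `v` is the mass of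
its columns of level `v`. [folklore] -/
theorem weight_levelIndicator (γ : Fin m → ℕ) (v : ℕ) (M : (Fin m × Fin m) →₀ ℕ) :
    Finsupp.weight (fun e : Fin m × Fin m => if γ e.2 = v then 1 else 0) M =
      ∑ j ∈ Finset.univ.filter (fun j => γ j = v), ∑ i, M (i, j) := by
  rw [Finsupp.weight_apply, Finsupp.sum_fintype _ _ (fun _ => by simp), Fintype.sum_prod_type,
    Finset.sum_comm, Finset.sum_filter]
  refine Finset.sum_congr rfl fun j _ => ?_
  by_cases hj : γ j = v <;> simp [hj]

/-- Hence the `W`-weight of an exponent with row sums `v · 𝟙{ρ = v}` is at most its mass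
`v · #{ρ = v}`. [folklore] -/
theorem weight_le (ρ γ : Fin m → ℕ) (v : ℕ) {M : (Fin m × Fin m) →₀ ℕ}
    (hr : ∀ i, ∑ j, M (i, j) = if ρ i = v then v else 0) :
    Finsupp.weight (fun e : Fin m × Fin m => if γ e.2 = v then 1 else 0) M ≤
      v * (Finset.univ.filter fun i => ρ i = v).card := by
  rw [weight_levelIndicator, ← sum_colSum_eq ρ v hr]
  exact Finset.sum_le_sum_of_subset (Finset.filter_subset _ _)

/-- **Equality case.**  If `#{ρ = v} = #{γ = v}`, the row sums are `v · 𝟙{ρ = v}`, the column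
sums are at most `γ`, and the `W`-weight is the full mass `v · #{ρ = v}`, then the column sums
are `v · 𝟙{γ = v}`: the columns off level `v` are empty, and the `#{γ = v}` columns of level `v`
carry at most `v` each with total `v · #{ρ = v}`. [folklore] -/
theorem colSum_eq_of_weight_eq (ρ γ : Fin m → ℕ) (v : ℕ)
    (hk : (Finset.univ.filter fun i => ρ i = v).card = (Finset.univ.filter fun j => γ j = v).card)
    {M : (Fin m × Fin m) →₀ ℕ} (hr : ∀ i, ∑ j, M (i, j) = if ρ i = v then v else 0)
    (hcol : ∀ j, ∑ i, M (i, j) ≤ γ j)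
    (hw : Finsupp.weight (fun e : Fin m × Fin m => if γ e.2 = v then 1 else 0) M =
      v * (Finset.univ.filter fun i => ρ i = v).card) (j : Fin m) :
    ∑ i, M (i, j) = if γ j = v then v else 0 := by
  have hF : ∑ j ∈ Finset.univ.filter (fun j => γ j = v), ∑ i, M (i, j) = ∑ j, ∑ i, M (i, j) := by
    rw [← weight_levelIndicator γ v M, hw, sum_colSum_eq ρ v hr]
  by_cases hj : γ j = v
  · rw [if_pos hj]
    have hle : ∀ j' ∈ Finset.univ.filter (fun j => γ j = v), ∑ i, M (i, j') ≤ v := fun j' hj' =>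
      (hcol j').trans (Finset.mem_filter.1 hj').2.le
    refine (Finset.sum_eq_sum_iff_of_le hle).1 ?_ j (Finset.mem_filter.2 ⟨Finset.mem_univ _, hj⟩)
    rw [Finset.sum_const, smul_eq_mul, ← hk, ← weight_levelIndicator γ v M, hw, mul_comm]
  · rw [if_neg hj]
    have h := Finset.sum_filter_add_sum_filter_not Finset.univ (fun j => γ j = v)
      (fun j => ∑ i, M (i, j))
    rw [hF] at h
    have h0 : ∑ j ∈ Finset.univ.filter (fun j => ¬γ j = v), ∑ i, M (i, j) = 0 := by omega
    exact Finset.sum_eq_zero_iff.1 h0 j (Finset.mem_filter.2 ⟨Finset.mem_univ _, hj⟩)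

/-- The level slice of a PURE typed exponent (inside the graph of `σ`) has empty columns off
level `v`: a cell `(i, j)` of the slice has `ρ i = v` and `i = σ j`, and `ρ (σ j) = γ j`.
[folklore] -/
theorem colSum_slice_pure (ρ γ : Fin m → ℕ) (v : ℕ) {A : (Fin m × Fin m) →₀ ℕ}
    (hr : ∀ i, ∑ j, A (i, j) = ρ i) (hc : ∀ j, ∑ i, A (i, j) = γ j)
    {σ : Equiv.Perm (Fin m)} (hA : ∀ e ∈ A.support, e.1 = σ e.2) (j : Fin m) (hj : γ j ≠ v) :
    ∑ i, (A.filter (fun e => ρ e.1 = v)) (i, j) = 0 := by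
  refine Finset.sum_eq_zero fun i _ => ?_
  rw [Finsupp.filter_apply]
  split_ifs with hi
  · by_contra hne
    have h1 : i = σ j := hA (i, j) (Finsupp.mem_support_iff.2 hne)
    have h2 : ρ (σ j) = γ j := AlignedRigidity.typed_of_served hr hc σ hA j
    refine hj ?_
    rw [← h2, ← h1]
    exact hi
  · rfl

/-- Hence the `W`-weight of the level slice of a pure typed exponent is its full mass
`v · #{ρ = v}`. [folklore] -/
theorem weight_slice_pure (ρ γ : Fin m → ℕ) (v : ℕ) {A : (Fin m × Fin m) →₀ ℕ}
    (hr : ∀ i, ∑ j, A (i, j) = ρ i) (hc : ∀ j, ∑ i, A (i, j) = γ j)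
    {σ : Equiv.Perm (Fin m)} (hA : ∀ e ∈ A.support, e.1 = σ e.2) :
    Finsupp.weight (fun e : Fin m × Fin m => if γ e.2 = v then 1 else 0)
        (A.filter (fun e => ρ e.1 = v)) =
      v * (Finset.univ.filter fun i => ρ i = v).card := by
  rw [weight_levelIndicator, ← sum_colSum_eq ρ v (rowSum_slice ρ v hr)]
  refine Finset.sum_filter_of_ne fun j _ hne => ?_
  by_contra hj
  exact hne (colSum_slice_pure ρ γ v hr hc hA j hj)

/-- **The top `W`-weight of the level projection of a typed `c` with a pure exponent is
`v · #{ρ = v}`.** [folklore] -/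
theorem weightedTotalDegree_aeval_prj (ρ γ : Fin m → ℕ) (v : ℕ)
    (c : MvPolynomial (Fin m × Fin m) ℝ≥0)
    (hc : ∀ M ∈ c.support, (∀ i, ∑ j, M (i, j) = ρ i) ∧ (∀ j, ∑ i, M (i, j) = γ j))
    (hpure : ∃ A ∈ c.support, ∃ σ : Equiv.Perm (Fin m), ∀ e ∈ A.support, e.1 = σ e.2) :
    weightedTotalDegree (fun e : Fin m × Fin m => if γ e.2 = v then 1 else 0)
        (aeval (fun e : Fin m × Fin m =>
          if ρ e.1 = v then (X e : MvPolynomial (Fin m × Fin m) ℝ≥0) else 1) c) =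
      v * (Finset.univ.filter fun i => ρ i = v).card := by
  apply le_antisymm
  · refine Finset.sup_le fun M hM => ?_
    obtain ⟨A, hA, rfl⟩ := (mem_support_aeval_prj_iff ρ v c M).1 hM
    exact weight_le ρ γ v (rowSum_slice ρ v (hc A hA).1)
  · obtain ⟨A, hA, σ, hAσ⟩ := hpure
    rw [← weight_slice_pure ρ γ v (hc A hA).1 (hc A hA).2 hAσ]
    exact le_weightedTotalDegree _ ((mem_support_aeval_prj_iff ρ v c _).2 ⟨A, hA, rfl⟩)

/-! ### The stub -/

/-- **stub_levelSlice — slicing one LEVEL out of a typed factor is free.**  Let `c` be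
torus-homogeneous on the `m`-board with row margins `ρ` and column margins `γ`, let `v ≥ 1`, and
suppose `c` has some PURE exponent (one supported inside the graph `{(σ j, j)}` of a permutation
`σ`).  Then (i) the level sets `{i | ρ i = v}` and `{j | γ j = v}` have the same size — a pure
exponent `A` inside `σ` has in column `j` the single cell `(σ j, j)` carrying the whole row
margin, so `γ j = ρ (σ j)` for all `j` (`AlignedRigidity.typed_of_served`) and `γ = ρ ∘ σ`; and
(ii) there is `c'` on the same board, no dearer than `c`, all of whose exponents have row margins
`v·𝟙{ρ i = v}` and column margins `v·𝟙{γ j = v}`, and which contains the level-`v` slice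
`A.filter (ρ ·.1 = v)` of EVERY pure exponent `A` of `c`.  Construction: `c' := top_W (prj c)`
with the level projection `prj x_e = x_e` if `ρ e.1 = v`, `prj x_e = 1` otherwise (free:
`IsProjection.complexity_le_holds`; it maps `x^A ↦ x^{A.filter (ρ ·.1 = v)}`) and the column
weight `W e := 𝟙{γ e.2 = v}` (top components are free: `complexity_topComponent_le`).  Every
exponent of `prj c` has row margins `v·𝟙{ρ = v}`, total mass `v·k` (`k = #{ρ = v}`), column sums
`≤ γ j`, hence `W`-weight `≤ v·k`; the slice of a pure exponent puts its whole mass into the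
columns `σ⁻¹{ρ = v} = {γ = v}`, so it has `W`-weight exactly `v·k` = the top weight; and an
exponent of top weight `v·k` has all its mass in the `k` columns `{γ = v}`, each carrying `≤ v`,
hence exactly `v`. [folklore] -/
theorem stub_levelSlice :
    ∀ (m : ℕ) (c : MvPolynomial (Fin m × Fin m) ℝ≥0) (ρ γ : Fin m → ℕ) (v : ℕ), 1 ≤ v →
      (∀ M ∈ c.support, (∀ i, ∑ j, M (i, j) = ρ i) ∧ (∀ j, ∑ i, M (i, j) = γ j)) →
      (∃ A ∈ c.support, ∃ σ : Equiv.Perm (Fin m), ∀ e ∈ A.support, e.1 = σ e.2) →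
      (Finset.univ.filter fun i => ρ i = v).card = (Finset.univ.filter fun j => γ j = v).card ∧
      ∃ c' : MvPolynomial (Fin m × Fin m) ℝ≥0, complexity c' ≤ complexity c ∧
        (∀ M ∈ c'.support, (∀ i, ∑ j, M (i, j) = if ρ i = v then v else 0) ∧
          (∀ j, ∑ i, M (i, j) = if γ j = v then v else 0)) ∧
        (∀ A ∈ c.support, (∃ σ : Equiv.Perm (Fin m), ∀ e ∈ A.support, e.1 = σ e.2) →
          A.filter (fun e => ρ e.1 = v) ∈ c'.support) := by
  intro m c ρ γ v _ hc hpure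
  -- (i) `j ↦ σ j` is a bijection `{γ = v} → {ρ = v}` for the permutation `σ` of a pure exponent
  have hk : (Finset.univ.filter fun i => ρ i = v).card =
      (Finset.univ.filter fun j => γ j = v).card := by
    obtain ⟨A, hA, σ, hAσ⟩ := hpure
    have hσ : ∀ j, ρ (σ j) = γ j :=
      AlignedRigidity.typed_of_served (hc A hA).1 (hc A hA).2 σ hAσ
    symm
    refine Finset.card_bij (fun j _ => σ j) (fun j hj => ?_) (fun j₁ _ j₂ _ h => σ.injective h)
      (fun i hi => ⟨σ.symm i, ?_, σ.apply_symm_apply i⟩)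
    · simp only [Finset.mem_filter, Finset.mem_univ, true_and] at hj ⊢
      rw [hσ, hj]
    · simp only [Finset.mem_filter, Finset.mem_univ, true_and] at hi ⊢
      rw [← hσ, Equiv.apply_symm_apply, hi]
  refine ⟨hk, topComponent (fun e : Fin m × Fin m => if γ e.2 = v then 1 else 0)
    (aeval (fun e : Fin m × Fin m =>
      if ρ e.1 = v then (X e : MvPolynomial (Fin m × Fin m) ℝ≥0) else 1) c), ?_, ?_, ?_⟩
  · -- (ii) cost: top components and projections are free
    refine (complexity_topComponent_le _ _).trans ?_
    refine IsProjection.complexity_le_holds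
      ⟨fun e => if ρ e.1 = v then X e else 1, fun e => ?_, rfl⟩
    by_cases he : ρ e.1 = v
    · exact Or.inl ⟨e, if_pos he⟩
    · refine Or.inr ⟨1, ?_⟩
      show (if ρ e.1 = v then X e else 1) = C 1
      rw [if_neg he, C_1]
  · -- (ii) margins of the exponents of the top component
    intro M hM
    have hw : Finsupp.weight (fun e : Fin m × Fin m => if γ e.2 = v then 1 else 0) M =
        v * (Finset.univ.filter fun i => ρ i = v).card := by
      rw [← weightedTotalDegree_aeval_prj ρ γ v c hc hpure]
      by_contra hne
      refine (mem_support_iff.1 hM) ?_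
      rw [coeff_topComponent, if_neg hne]
    obtain ⟨A, hA, rfl⟩ :=
      (mem_support_aeval_prj_iff ρ v c M).1 (support_topComponent_subset _ _ hM)
    have hr := rowSum_slice ρ v (hc A hA).1
    exact ⟨hr, colSum_eq_of_weight_eq ρ γ v hk hr
      (fun j => (colSum_slice_le ρ v A j).trans ((hc A hA).2 j).le) hw⟩
  · -- (ii) the slice of every pure exponent has the top weight
    rintro A hA ⟨σ, hAσ⟩
    rw [mem_support_iff, coeff_topComponent, weightedTotalDegree_aeval_prj ρ γ v c hc hpure,
      if_pos (weight_slice_pure ρ γ v (hc A hA).1 (hc A hA).2 hAσ)]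
    exact mem_support_iff.1 ((mem_support_aeval_prj_iff ρ v c _).2 ⟨A, hA, rfl⟩)

end Summit.ValiantsHypothesis.ValiantsHypothesis.Theorems.DivisionGap.PerMultiplesHard.LevelSlice

end
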